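import Summits.ABC.IUTFork.Joshi.ATS4MainBoundsGenuine
import Summits.ABC.IUTFork.Joshi.ATS4TateDivisorLegendre
import Literature.IUT.LogVolume.Theorem110GenuineStepII
import HarnessLib

/-!
# Joshi, *Arithmetic Teichmüller spaces IV* [J-IV] Lemma 6.4.2 (1)(2), the second inequality of Theorem 6.1.1 — and, under
# Prop. 4.1.1 (2), Lemma 6.4.1 — UNCONDITIONAL on the genuine Legendre theta tower `F_tpd ⊆ F ⊆ K`

Proof-only companion of `Joshi/ATS4MainBoundsGenuine.lean` (p439256) and `Joshi/ATS4TateDivisorLegendre.lean` (T-26, p430434)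
(slot T-30 of plan/E/ASSIGNMENTS.md; abc-iut cell, block E, rung LADDER-ABC:A2.E). TAKES NO SIDE on [IUTchIII] Cor. 3.12, on Joshi's
claims, or on Mochizuki's reports on them; the source is an unrefereed arXiv preprint (arXiv:2403.10430v2, bib `Joshi2024ATS4`);
typed ≠ proved ≠ endorsed. NOT an abc claim: the [J-III] Cor. 9.11.1.1 / [IUTchIII] Cor. 3.12 input of Thm. 6.1.1's FIRST
inequality is untouched; only the elementary-number-theory lemmata of §6.4 are discharged.

## The data (Joshi's `L_tpd ⊆ L ⊆ L′` ↦ Mochizuki's `F_tpd ⊆ F ⊆ K`, Rmk. 6.1.2; Thm. 5.7.1's curve `C_λ` is the Legendre curve)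

`P : NFPoint` a point `λ ∈ U_X(F_tpd)` of the tree's `λ`-line ([IUTchIV] Cor. 2.2), `F` a theta field of `P`
(`Cor22.IsThetaField P F`: «`F = F_tpd(√−1, E_{F_tpd}[3·5])`» = Joshi's §4.1.2 (9)), `K ⊇ F` Galois inside the `ℓ`-division field of
the Legendre curve `E_F` (an `F`-embedding `ψ : K → F̄` with `ker ρ̄_{E_F,ℓ} ≤ Gal(F̄/ψ K)`; Joshi's `L′`), `ℓ ≥ 7` prime. The three
Tate-divisor data are T-26's `TateDivisorDatum.ofNFPoint (·) {2, ℓ}` (Def. 4.4.2 on the `λ`-line: `V` = bad places of odd residue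
characteristic `≠ ℓ` — Joshi's `V^{odd,ss}`, which by his Prop. 4.1.1 (2) contains no place over `2ℓ`), and the datum is
`MainBoundDatum.ofGenuine L_mod … (ofNFPoint P {2,ℓ}) (ofNFPointOver P {2,ℓ} F) (ofNFPointOver P {2,ℓ} K)`, `ofNFPointOver P S M := ofNFPoint (extend P M) S`
re-indexed over `M` (any `L_mod`: §6.4 does not read `d_mod`, `e_mod`).

## Results (hypotheses: `P.InU`, `IsThetaField P F`, `[IsGalois F K]`, the kernel condition on `ψ`, `ℓ ≥ 7` prime, and
## `0 < log(𝔮_F)` = «V^{odd,ss} ≠ ∅» (Thm. 5.7.1 via Lem. 5.8.9, kept as the hypothesis `hq`); nothing else)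

* `thetaTower_sharp642` — `log(d^{L′}) + log(f^{L′}) ≤ log(d^{L_tpd}) + log(f^{L_tpd}) + log(2¹¹·3³·5²) + 2·log ℓ` in Joshi's
  vocabulary: the tree's hypothesis-free `Cor22.ndeg_differentDivisor_add_logCondOver_thetaTower_le` (Theorem110GenuineStepII)
  transported by §1's identifications `log(𝔣_{F_tpd}) = logCondAvoid P {2,ℓ}`, `log(𝔣_{L′}) = logCondOver P {2,ℓ} K`
  (`logf_ofNFPoint_eq_logCondAvoid`, `logf_ofNFPointOver_eq_logCondOver`).
* `thetaTower_lem642a`, `thetaTower_lem642b` — **Lemma 6.4.2 (1), (2) hold for the genuine datum**; `thetaTower_diffCondMono`,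
  `thetaTower_thm611_iff` — the second inequality of Thm. 6.1.1 holds, so Thm. 6.1.1 there IS its first inequality;
  `thetaTower_degLLtpdBound` (`IsThetaField.finrank_dvd`), `thetaTower_degLpLBound` (`finrank_divisionTower_dvd`).
* `thetaTower_lem641` — **Lemma 6.4.1** for `F/F_tpd`, additionally assuming Joshi's Prop. 4.1.1 (2) «no place of multiplicative
  reduction over `ℓ`» (`hℓ' : ∀ v ∈ badPlaces P, (ℓ) ⊄ v`), from `ofGenuine_lem641` with (D0) `ramificationIdx_thetaField_eq_one` and
  `not_dvd_ramificationIdx_thetaField` (the tree's Prop. 1.8 (vi)(vii) instances); `ℓ ≥ 5` suffices here.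

Theorems + one re-indexing `abbrev` (`TateDivisorDatum.ofNFPointOver`); standard axioms; no `sorry`, instance, notation or new `Prop` fact.
-/

noncomputable section

open NumberField IsDedekindDomain Literature.IUT.LogVolume Literature.IUT.LogVolume.Cor22
open Literature.NumberTheory.DiophantineGeometry.GenEll

namespace Summit.ABC.IUTFork.Joshi.ATS4

/-! ## 1. T-26's Tate-divisor data on the `λ`-line = the tree's Step (ii) conductor quantities -/

namespace TateDivisorDatum

/-- **T-26's Tate-divisor datum of `λ` regarded over a finite extension `M ⊇ F_tpd`, typed over `M`**: `ofNFPoint (extend P M) S`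
(«`x ∈ U_X(F_tpd) ⊆ U_X(M)`», [IUTchIV] p.42; `(Cor22.extend P M).F` is `M` by definition — this abbreviation only fixes the
index of the signature so that instances are found on `M`). DICTIONARY, nothing asserted. [claim: Joshi2024ATS4, status: disputed] -/
abbrev ofNFPointOver (P : NFPoint) (S : Finset ℕ) (M : Type) [Field M] [NumberField M] [Algebra P.F M] : TateDivisorDatum M :=
  ofNFPoint (extend P M) S

/-- `Supp(𝔮_{F_tpd})` away from `S` IS the tree's `badPlacesAvoid P S`. [folklore] -/
theorem ofNFPoint_V_eq (P : NFPoint) (S : Finset ℕ) : (ofNFPoint P S).V = badPlacesAvoid P S := rfl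

/-- `log(𝔣_{F_tpd}) = logCondAvoid P S` ([IUTchIV] Thm. 1.10 p.23 «the conductor»). [cite: Mochizuki2012, IUTchIV Thm. 1.10 p. 23] -/
theorem logf_ofNFPoint_eq_logCondAvoid (P : NFPoint) (S : Finset ℕ) : (ofNFPoint P S).logf = logCondAvoid P S := by
  rw [logCondAvoid_eq_ndeg_reduced]
  rfl

section Over

variable (P : NFPoint) (S : Finset ℕ) (M : Type) [Field M] [NumberField M] [Algebra P.F M]

/-- Support compatibility over `F_tpd` (T-26's `isBaseChangeOf_ofNFPoint`, first half, re-indexed over `M`): a place of `M` is in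
`Supp(𝔮_M)` iff the place of `F_tpd` below it is in `Supp(𝔮_{F_tpd})`. [folklore] -/
theorem mem_ofNFPointOver_V_iff (w : HeightOneSpectrum (𝓞 M)) : w ∈ (ofNFPointOver P S M).V ↔ finBelow P.F M w ∈ (ofNFPoint P S).V := by
  letI : Algebra P.F (extend P M).F := ‹Algebra P.F M›
  exact (isBaseChangeOf_ofNFPoint (P := P) (Q := extend P M) rfl S).1 w

/-- `Supp(𝔮_M)` away from `S` IS the tree's `badPlacesOver P S M` (the places over `Supp(𝔮_{F_tpd})`).
[cite: Mochizuki2012, IUTchIV Thm. 1.10 p. 23] -/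
theorem ofNFPointOver_V_eq : (ofNFPointOver P S M).V = badPlacesOver P S M := by
  ext w
  rw [mem_badPlacesOver_iff, mem_ofNFPointOver_V_iff]
  have hfb : finBelow P.F M w = w.under (𝓞 P.F) := HeightOneSpectrum.ext rfl
  rw [hfb, ofNFPoint_V_eq]

/-- `log(𝔣_M) = logCondOver P S M`. [cite: Mochizuki2012, IUTchIV Thm. 1.10 p. 23] -/
theorem logf_ofNFPointOver_eq_logCondOver : (ofNFPointOver P S M).logf = logCondOver P S M := by
  rw [logCondOver_eq_ndeg_reduced, ← ofNFPointOver_V_eq]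
  rfl

end Over

/-- `log(d^{F_tpd}) = log-diff(λ)` (T-26's `logDifferent` vs the tree's `NFPoint.logDiff`). [cite: MochizukiGenEll2010, Def. 1.5 (iii) p.9] -/
theorem logDifferent_eq_logDiff (P : NFPoint) : logDifferent P.F = P.logDiff :=
  (logDiff_eq_ndeg_differentDivisor P).symm

end TateDivisorDatum

/-! ## 2. §6.4 on the genuine theta tower -/

namespace MainBoundDatum

section Theta

variable (Lmod : Type*) [Field Lmod] [NumberField Lmod]
variable {P : NFPoint} {F : Type} [Field F] [NumberField F] [Algebra P.F F]
  {K : Type} [Field K] [NumberField K] [Algebra F K] [Algebra P.F K] [IsScalarTower P.F F K]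
  (ψ : K →ₐ[F] AlgebraicClosure F)
variable {ℓ : ℕ} (hℓ : ℓ.Prime) (h5 : 5 ≤ ℓ)
variable (hq : 0 < (TateDivisorDatum.ofNFPointOver P {2, ℓ} F).logq)

include hℓ in
open TateDivisorDatum in
/-- **[IUTchIV] Step (ii) for the genuine theta tower in Joshi's vocabulary**: `log(d^{L′}) + log(f^{L′}) ≤ log(d^{L_tpd}) +
log(f^{L_tpd}) + log(2¹¹·3³·5²) + 2·log ℓ` for `L_tpd = P.F`, `L′ = K`, Tate-divisor data `ofNFPoint · {2,ℓ}` — hypothesis-free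
apart from the data (tree `Cor22.ndeg_differentDivisor_add_logCondOver_thetaTower_le`). [claim: Mochizuki2012, status: disputed] -/
theorem thetaTower_sharp642 (hU : P.InU) (hF : IsThetaField P F) [IsGalois F K] (h7 : 7 ≤ ℓ)
    (hK : letI := thetaCurve_isElliptic hU F
      ((thetaCurve P F).galoisRepTorsion (ℓ : ℤ)).ker ≤ ψ.fieldRange.fixingSubgroup) :
    logDifferent K + (ofNFPointOver P {2, ℓ} K).logf ≤
      logDifferent P.F + (ofNFPoint P {2, ℓ}).logf + (Real.log (2 ^ 11 * 3 ^ 3 * 5 ^ 2) + 2 * Real.log ℓ) := by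
  have h := ndeg_differentDivisor_add_logCondOver_thetaTower_le ψ hU hF hℓ h7 hK
  rw [← logf_ofNFPointOver_eq_logCondOver, ← logf_ofNFPoint_eq_logCondAvoid, ← logDifferent_eq_logDiff] at h
  exact h

/-- **Lemma 6.4.2 (1) UNCONDITIONAL on the genuine theta tower** («log(d^{L′}) ≤ log(d^{L′}) + log(f^{L′}) ≤ log(d^{L_tpd}) +
log(f^{L_tpd}) + 4·log(ℓ) + 33», p.59 l.37–p.60 l.5), for the genuine datum of the tower (`21 + 2·log ℓ ≤ 33 + 4·log ℓ`).
[claim: Joshi2024ATS4, status: disputed] -/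
theorem thetaTower_lem642a (hU : P.InU) (hF : IsThetaField P F) [IsGalois F K] (h7 : 7 ≤ ℓ)
    (hK : letI := thetaCurve_isElliptic hU F
      ((thetaCurve P F).galoisRepTorsion (ℓ : ℤ)).ker ≤ ψ.fieldRange.fixingSubgroup) :
    (ofGenuine Lmod hℓ h5 (TateDivisorDatum.ofNFPoint P {2, ℓ})
      (TateDivisorDatum.ofNFPointOver P {2, ℓ} F)
      (TateDivisorDatum.ofNFPointOver P {2, ℓ} K) hq).Lem642a := by
  have key := thetaTower_sharp642 ψ hℓ hU hF h7 hK
  have h21 := log_two_pow_eleven_mul_le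
  have hlog : 0 ≤ Real.log (ℓ : ℝ) := Real.log_nonneg (by exact_mod_cast hℓ.one_lt.le)
  have hf := (TateDivisorDatum.ofNFPointOver P {2, ℓ} K).logf_nonneg
  unfold Lem642a
  refine ⟨?_, ?_⟩
  · show logDifferent K ≤ logDifferent K + (TateDivisorDatum.ofNFPointOver P {2, ℓ} K).logf
    linarith
  · show logDifferent K + (TateDivisorDatum.ofNFPointOver P {2, ℓ} K).logf ≤
      logDifferent P.F + (TateDivisorDatum.ofNFPoint P {2, ℓ}).logf + 4 * Real.log ((ℓ : ℕ) : ℝ) + 33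
    linarith

/-- **Lemma 6.4.2 (2) UNCONDITIONAL on the genuine theta tower** («(1 + 4/ℓ)·log(d^{L′}) ≤ (1 + 4/ℓ)·(log(d^{L_tpd}) + log(f^{L_tpd}))
+ 4·log(ℓ) + 74», p.60 l.6–21). [claim: Joshi2024ATS4, status: disputed] -/
theorem thetaTower_lem642b (hU : P.InU) (hF : IsThetaField P F) [IsGalois F K] (h7 : 7 ≤ ℓ)
    (hK : letI := thetaCurve_isElliptic hU F
      ((thetaCurve P F).galoisRepTorsion (ℓ : ℤ)).ker ≤ ψ.fieldRange.fixingSubgroup) :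
    (ofGenuine Lmod hℓ h5 (TateDivisorDatum.ofNFPoint P {2, ℓ})
      (TateDivisorDatum.ofNFPointOver P {2, ℓ} F)
      (TateDivisorDatum.ofNFPointOver P {2, ℓ} K) hq).Lem642b :=
  lem642b_of_lem642a _ (thetaTower_lem642a Lmod ψ hℓ h5 hq hU hF h7 hK)

omit [IsScalarTower P.F F K] in
/-- **The second inequality of Theorem 6.1.1 (Thm. 4.6.1 (2) for `L/L_tpd`) UNCONDITIONAL on the genuine theta tower** — for any
finite `F ⊇ F_tpd` in fact (support compatibility only). [claim: Joshi2024ATS4, status: disputed] -/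
theorem thetaTower_diffCondMono :
    (ofGenuine Lmod hℓ h5 (TateDivisorDatum.ofNFPoint P {2, ℓ})
      (TateDivisorDatum.ofNFPointOver P {2, ℓ} F)
      (TateDivisorDatum.ofNFPointOver P {2, ℓ} K) hq).DiffCondMono :=
  ofGenuine_diffCondMono Lmod hℓ h5 _ _ _ hq (TateDivisorDatum.mem_ofNFPointOver_V_iff P {2, ℓ} F)

omit [IsScalarTower P.F F K] in
/-- **Theorem 6.1.1 on the genuine theta tower IS its first inequality** (`(1/6)·log(𝔮_F) ≤ (1 + 20·d_mod/ℓ)·(log-diff(λ) +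
logCondAvoid P {2,ℓ}) + 20·(e*_mod·ℓ + 60)`, the [IUTchIV] Thm. 1.10 display at `η_prm = 60`). [claim: Joshi2024ATS4, status: disputed] -/
theorem thetaTower_thm611_iff :
    (ofGenuine Lmod hℓ h5 (TateDivisorDatum.ofNFPoint P {2, ℓ})
      (TateDivisorDatum.ofNFPointOver P {2, ℓ} F)
      (TateDivisorDatum.ofNFPointOver P {2, ℓ} K) hq).Thm611 ↔
    1 / 6 * (TateDivisorDatum.ofNFPointOver P {2, ℓ} F).logq ≤
      (ofGenuine Lmod hℓ h5 (TateDivisorDatum.ofNFPoint P {2, ℓ})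
        (TateDivisorDatum.ofNFPointOver P {2, ℓ} F)
        (TateDivisorDatum.ofNFPointOver P {2, ℓ} K) hq).boundLtpd :=
  ofGenuine_thm611_iff Lmod hℓ h5 _ _ _ hq (TateDivisorDatum.mem_ofNFPointOver_V_iff P {2, ℓ} F)

omit [IsScalarTower P.F F K] in
/-- **`[L : L_tpd] ≤ 2¹⁰·3²·5` on the genuine theta tower** (`IsThetaField.finrank_dvd`: «`Gal(F/F_tpd) ↪ GL₂(𝔽₃) × GL₂(𝔽₅) ×
ℤ/2ℤ`», `46080 = 2¹⁰·3²·5`). [claim: Joshi2024ATS4, status: disputed] -/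
theorem thetaTower_degLLtpdBound (hF : IsThetaField P F) :
    (ofGenuine Lmod hℓ h5 (TateDivisorDatum.ofNFPoint P {2, ℓ})
      (TateDivisorDatum.ofNFPointOver P {2, ℓ} F)
      (TateDivisorDatum.ofNFPointOver P {2, ℓ} K) hq).DegLLtpdBound := by
  refine ofGenuine_degLLtpdBound Lmod hℓ h5 _ _ _ hq ?_
  have h := hF.finrank_dvd
  norm_num at h ⊢
  exact h

omit [IsScalarTower P.F F K] in
/-- **`[L′ : L] ≤ ℓ⁴` on the genuine theta tower** (`finrank_divisionTower_dvd`: «`Gal(K/F) ↪ GL₂(𝔽_ℓ)`»).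
[claim: Joshi2024ATS4, status: disputed] -/
theorem thetaTower_degLpLBound (hU : P.InU)
    (hK : letI := thetaCurve_isElliptic hU F
      ((thetaCurve P F).galoisRepTorsion (ℓ : ℤ)).ker ≤ ψ.fieldRange.fixingSubgroup) :
    (ofGenuine Lmod hℓ h5 (TateDivisorDatum.ofNFPoint P {2, ℓ})
      (TateDivisorDatum.ofNFPointOver P {2, ℓ} F)
      (TateDivisorDatum.ofNFPointOver P {2, ℓ} K) hq).DegLpLBound :=
  haveI : Fact ℓ.Prime := ⟨hℓ⟩
  ofGenuine_degLpLBound Lmod hℓ h5 _ _ _ hq (finrank_divisionTower_dvd ψ hU hK)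

omit [IsScalarTower P.F F K] in
/-- **Lemma 6.4.1 on the genuine theta field** («log(d^L) + log(f^L) ≤ log(d^{L_tpd}) + log(f^{L_tpd}) + 33», p.59 l.25–27; in fact
`+ log(2¹¹·3³·5²)`) for `F/F_tpd`, assuming in addition Joshi's Prop. 4.1.1 (2) «`C` has good or additive reduction at the
places over `2ℓ`», i.e. no bad place of `λ` lies over `ℓ` (`hℓ'`) — then `Supp(𝔮_{F_tpd})` away from `{2,ℓ}` is all bad places
of odd residue characteristic, and the (D0)-type facts `ramificationIdx_thetaField_eq_one` (unramified at the good places of residue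
characteristic `∤ 30`) and `not_dvd_ramificationIdx_thetaField` (tame away from `2·3·5`) discharge the hypotheses of `ofGenuine_lem641`.
[claim: Joshi2024ATS4, status: disputed] -/
theorem thetaTower_lem641 (hU : P.InU) (hF : IsThetaField P F)
    (hℓ' : ∀ v ∈ badPlaces P, ((ℓ : ℕ) : 𝓞 P.F) ∉ v.asIdeal) :
    (ofGenuine Lmod hℓ h5 (TateDivisorDatum.ofNFPoint P {2, ℓ})
      (TateDivisorDatum.ofNFPointOver P {2, ℓ} F)
      (TateDivisorDatum.ofNFPointOver P {2, ℓ} K) hq).Lem641 := by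
  haveI := hF.isGalois
  refine ofGenuine_lem641 Lmod hℓ h5 _ _ _ hq (TateDivisorDatum.mem_ofNFPointOver_V_iff P {2, ℓ} F) ?_ ?_ ?_
  · have h := hF.finrank_dvd
    norm_num at h ⊢
    exact h
  · intro w hw hV
    refine ramificationIdx_thetaField_eq_one F hU hF w (thirty_notMem_finBelow_of_residueChar_notMem w hw) ?_
    intro hbad
    apply hV
    rw [TateDivisorDatum.mem_ofNFPoint_V]
    refine ⟨hbad, fun p hp => ?_⟩
    simp only [Finset.mem_insert, Finset.mem_singleton] at hp
    rcases hp with rfl | rfl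
    · intro h2
      rw [natCast_mem_asIdeal_iff_residueChar_eq _ Nat.prime_two, residueChar_finBelow] at h2
      simp only [Finset.mem_insert, Finset.mem_singleton, not_or] at hw
      exact hw.1 h2
    · exact hℓ' _ hbad
  · intro w hw _
    simp only [Finset.mem_insert, Finset.mem_singleton, not_or] at hw
    exact not_dvd_ramificationIdx_thetaField F hF w (residueChar_prime F w) hw.1 hw.2.1 hw.2.2

end Theta

end MainBoundDatum

end Summit.ABC.IUTFork.Joshi.ATS4

end
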